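import Summits.ResolutionOfSingularities.ResolutionOfSingularities.Theorems.PurelyInseparableDim4PureLeafGlobalWin15
import HarnessLib
import HarnessLib.Audit.Tags

/-!
# Purely inseparable fourfolds — PURE «d = 0» LEAVES WIN THE GLOBAL GAME over `𝔽₂` (single node 700)
# [OURS · counted 0 · kernel certificates about OUR frame v4 (MODE 1h, plain GLOBAL game `Edge`), not about resolution]

Width seat `res-dim4-p-10` (g2), desk WORD #60 (D3a).  Books-free win rows (`WinCertF.stateWins_of_row`,
children cited by name) for the F-nodes of the MODE-1h (cardinality-first, lex ties) win DAGs of EVERY pure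
monomial leaf `x^a`, `a ∈ {0..4}⁴` with an odd entry and `|a| ≥ 2` (54 roots up to renaming), in
the PLAIN GLOBAL game over `𝔽₂` at `q = 2` (B answers with every `𝔽₂`-rational equimultiple chart point,
along-centre moves included).  Each `wN : ∀ r exc, StateWins 2 ⟨evalT L, r, exc⟩` = «every booking of this polynomial is an
A-win of the plain global game» (hence `InScopeStateWins 2`).  Nodes are ordered by height (children first); this file holds
the single heavy node 700 of 700 (one `decide +kernel` per file to fit the gate budget).  Generated from `work/py/genbatch.py` (session folder of res-dim4-p-10 g2); every
row is re-checked by `decide` at the gate.  Riders: over `𝔽₂` only (no ascent to larger fields); MODE 1h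
only; exponents ≤ 4 only; the leaf property itself is NOT absorbing along the centre (`…LeafStepSpecimens`
X1) — the point is that A still WINS.  Nothing here proves resolution of singularities in dimension ≥ 4 /
characteristic `p`; counted 0; AI work, weaker than expert review. bears_on: LADDER-RESOLUTION:D157-DOOR2
(res-dim4-pi · WORD #60 D3a · LEAF-GLOBAL row). Supports stmt-ResolutionOfSingularities-16155 (helper).
-/

set_option linter.dupNamespace false

noncomputable section

namespace Summit.ResolutionOfSingularities.ResolutionOfSingularities.Theorems.PIDim4

namespace PureLeafGlobalWin

open StepKit WinCertF
/-- Node 700 (height 6): `x₀⁴x₁⁴x₂⁴x₃³`, centre `{0}`, 8 child polynomial(s). [OURS · certificate row] -/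
theorem w700 : ∀ (r : Fin 4 →₀ ℕ) (exc : Finset (Fin 4)),
    StateWins 2 (⟨evalT ([(![4, 4, 4, 3], 1)] : Terms 4 (ZMod 2)), r, exc⟩ : State (ZMod 2)) :=
  stateWins_of_row (C := [[(![2, 4, 4, 3], 1)], [(![2, 4, 4, 1], 1), (![2, 4, 4, 3], 1)], [(![2, 4, 0, 3], 1), (![2, 4, 4, 3], 1)], [(![2, 4, 0, 1], 1), (![2, 4, 0, 3], 1), (![2, 4, 4, 1], 1), (![2, 4, 4, 3], 1)], [(![2, 0, 4, 3], 1), (![2, 4, 4, 3], 1)], [(![2, 0, 4, 1], 1), (![2, 0, 4, 3], 1), (![2, 4, 4, 1], 1), (![2, 4, 4, 3], 1)], [(![2, 0, 0, 3], 1), (![2, 0, 4, 3], 1), (![2, 4, 0, 3], 1), (![2, 4, 4, 3], 1)], [(![2, 0, 0, 1], 1), (![2, 0, 0, 3], 1), (![2, 0, 4, 1], 1), (![2, 0, 4, 3], 1), (![2, 4, 0, 1], 1), (![2, 4, 0, 3], 1), (![2, 4, 4, 1], 1), (![2, 4, 4, 3], 1)]])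
    (all_cons w662 (all_cons w673 (all_cons w672 (all_cons w682 (all_cons w671 (all_cons w679 (all_cons w677 (all_cons w685 (all_nil 2))))))))) (S := {0}) (by decide +kernel)

end PureLeafGlobalWin

end Summit.ResolutionOfSingularities.ResolutionOfSingularities.Theorems.PIDim4

end
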